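import Summits.AtomisticToContinuum.Crystallization.Theorems.ThreeConeCertificateExactCertificateNoGapNecessary
import Summits.AtomisticToContinuum.Crystallization.Theorems.ThreeConeCertificateExactCertificateFieldSummable

/-!
# `ExactCertificate` (stmt-AtomisticToContinuum-11959): CHARGE BLOW-UP — the tail system of a witness,
# its finite sections, their completeness, and the finite kill schema (line `Ideator4Sketch`, lead a2)

Line `Ideator4Sketch` (crux-ideate round 2, ideator 4; card `charge-blowup`) is a NEGATION lane: it composes
to the crux only through `¬ ExactCertificate`.  This file lands its kernel in tree vocabulary (no new defs).
The **tail section** of a periodic template `P` at range `ρ`, ceiling `C`, touch set `T` is: a radial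
positive-type `f` with `f 0 ≤ C`, `f ≤ V_LJ` on `[ρ,∞) ∩ (0,∞)`, `f = V_LJ` on `T`, and the NEUTRALITY ROW
`f 0 + 2 e_P(f·1_{(0,ρ)}) + 2 e_P(V_LJ·1_{[ρ,∞)}) = 0` (full system: `T` = all pair distances of `P` `≥ ρ`).
* `tailSection_of_isSplit` (L1, necessity with the CHARGE CEILING): a witness `(P, ρ', c, g, U, f)` puts its
  own `f` in the full tail section of `P` at every range `ρ ≥ ρ'` with ceiling `−2e(P)` — from `c ≥ 0` and the
  value equation alone (no `e*`); touches/neutrality = the tree's complementary slackness;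
* `tailSection_complete` (L2, COMPLETENESS of finite sections): finite sections along an exhausting chain of
  touch sets feasible with the SAME ceiling ⇒ the full section is feasible (pointwise ultralimit; the
  finite-range energy is a finite sum, `tendsto_energyPerParticle_core`); contrapositive = charge blow-up;
* `not_witness_of_section_empty` (L3, KILL SCHEMA): an empty section excludes every witness with template
  `P` and range `≤ ρ`;
* `section_empty_of_dual` (L4): a finite Schoenberg-dual certificate empties a section, GIVEN the Schoenberg
  transfer principle as an explicit hypothesis (Schoenberg 1938; never an axiom here);
* `exists_minimiser_tailSection_of_exactCertificate`: the crux hands the lane a PERIODIC MINIMISER of `e_LJ`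
  (`Slackness.periodicMinimum_of_witness`) with feasible full sections at every integer range beyond its own;
* `not_exactCertificate_of_tailEmpty` / `stub_chargeBlowup` (registered stub, verbatim): tail sections of
  periodic minimisers empty at every integer range ⇒ `¬ ExactCertificate`.
Honest limits: ranges are an up-set (`IsSplit.mono`) — a kill at `ρ` covers ranges `≤ ρ` only; the template
is pinned to "some periodic minimiser", which no tree theorem identifies (items 0627/11961); the card's
numerics put every accessible finite certificate two orders of magnitude below the ceiling.  All `[folklore]`.
-/

noncomputable section

namespace Summit.AtomisticToContinuum.Crystallization.Theorems.ThreeConeCertificateExactCertificate.ChargeBlowup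

open Literature.MathematicalPhysics.StatisticalMechanics
open Summit.AtomisticToContinuum.Crystallization.Theses.ThreeConeCertificate
open Summit.AtomisticToContinuum.Crystallization.Theorems.ChargedEnergyGapNegative (E3)
open Summit.AtomisticToContinuum.Crystallization.Theorems.ExactCertificateNegative (IsSplit exactCertificate_iff)
open Summit.AtomisticToContinuum.Crystallization.Theorems.ThreeConeCertificateExactCertificate.Slackness
  (summable_of_finRange f_eq_lennardJones_of_mem_points f_zero_add_two_mul_energyPerParticle_f summable_f_site
    periodicMinimum_of_witness)
open Summit.AtomisticToContinuum.Crystallization.Theorems.ThreeConeCertificateExactCertificate.Field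
  (f_zero_nonneg abs_le_f_zero)
open scoped BigOperators
open Filter Topology

/-! ## Finite-range truncations: the core energy is a finite sum, continuous in the potential -/

/-- The core truncation `r ↦ if r < ρ then φ r else 0` has finite range `ρ`. [folklore] -/
theorem core_of_le (ρ : ℝ) (φ : ℝ → ℝ) : ∀ r, ρ ≤ r → (fun r => if r < ρ then φ r else 0) r = 0 :=
  fun r hr => by simp [not_lt.2 hr]

/-- **The finite-range energy per particle is continuous in the potential for pointwise convergence**:
it is a FINITE sum over a fixed finite set of neighbours, independent of the potential. [folklore] -/
theorem tendsto_energyPerParticle_core (P : PeriodicConfiguration 3) (ρ : ℝ) {l : Filter ℕ}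
    (φ : ℕ → ℝ → ℝ) (ψ : ℝ → ℝ)
    (hφ : ∀ r : ℝ, 0 ≤ r → r < ρ → Tendsto (fun N => φ N r) l (𝓝 (ψ r))) :
    Tendsto (fun N => P.energyPerParticle (fun r => if r < ρ then φ N r else 0)) l
      (𝓝 (P.energyPerParticle (fun r => if r < ρ then ψ r else 0))) := by
  classical
  unfold PeriodicConfiguration.energyPerParticle
  refine Tendsto.const_mul _ (tendsto_finsetSum _ fun x _ => ?_)
  -- the neighbours of `x` within `ρ`: a finite set independent of the potential
  have hfin : {q : {q : E3 // q ∈ P.points ∧ q ≠ x} | dist x q.1 < ρ}.Finite := by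
    have h1 := P.finite_inter_points (Metric.isBounded_ball (x := x) (r := ρ))
    refine (h1.preimage Subtype.val_injective.injOn).subset ?_
    intro q hq
    exact ⟨by rw [Metric.mem_ball, dist_comm]; exact hq, q.2.1⟩
  have hzero : ∀ (χ : ℝ → ℝ) (q : {q : E3 // q ∈ P.points ∧ q ≠ x}), q ∉ hfin.toFinset →
      (fun r => if r < ρ then χ r else 0) (dist x q.1) = 0 := fun χ q hq => by
    apply core_of_le
    by_contra hlt
    exact hq (hfin.mem_toFinset.2 (not_le.1 hlt))
  have hrw : ∀ χ : ℝ → ℝ,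
      (∑' q : {q : E3 // q ∈ P.points ∧ q ≠ x}, (fun r => if r < ρ then χ r else 0) (dist x q.1))
        = ∑ q ∈ hfin.toFinset, (fun r => if r < ρ then χ r else 0) (dist x q.1) :=
    fun χ => tsum_eq_sum (hzero χ)
  simp only [hrw]
  refine tendsto_finsetSum _ fun q _ => ?_
  by_cases hq : dist x q.1 < ρ
  · simp only [hq, if_true]
    exact hφ _ dist_nonneg hq
  · simp only [hq, if_false]
    exact tendsto_const_nhds

/-- Along an ultrafilter on `ℕ`, a bounded real sequence converges to its `limUnder`. [folklore] -/
theorem tendsto_limUnder_of_abs_le (𝒰 : Ultrafilter ℕ) {u : ℕ → ℝ} {B : ℝ} (h : ∀ k, |u k| ≤ B) :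
    Tendsto u (𝒰 : Filter ℕ) (𝓝 (limUnder (𝒰 : Filter ℕ) u)) := by
  obtain ⟨x, -, hx⟩ := (isCompact_Icc (a := -B) (b := B)).ultrafilter_le_nhds' (𝒰.map u)
    (Ultrafilter.mem_map.2 (univ_mem' fun k => abs_le.1 (h k)))
  rw [Ultrafilter.coe_map] at hx
  exact tendsto_nhds_limUnder ⟨x, hx⟩

/-! ## L1 — necessity with the charge ceiling -/

section Witness

variable {P : PeriodicConfiguration 3} {ρ' c : ℝ} {g U f : ℝ → ℝ}

/-- **A witness puts its own `f` in the full tail section of its template, at every range beyond its own,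
with the template's own ceiling `−2e(P)`** (L1 of the card; no `e*`, no stability constant beyond `c ≥ 0`):
for a split `(ρ', c, g, U, f)` with `c + f 0/2 ≤ −e(P)` and every `ρ ≥ ρ'` — `f` is radially of positive
type, `f 0 ≤ −2e(P)`, `f ≤ V_LJ` on `[ρ,∞) ∩ (0,∞)`, `f = V_LJ` at every pair distance of `P` beyond `ρ`
(complementary slackness), and the neutrality row `f 0 + 2e_P(f·1_{(0,ρ)}) + 2e_P(V_LJ·1_{[ρ,∞)}) = 0`
(the `P`-sum of `f` vanishes; its tail part is the explicit `V_LJ`-tail sum termwise). [folklore] -/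
theorem tailSection_of_isSplit (hs : IsSplit ρ' c g U f)
    (hv : c + f 0 / 2 ≤ -(P.energyPerParticle lennardJones)) {ρ : ℝ} (hρ : ρ' ≤ ρ) :
    (∀ (m : ℕ) (y : Fin m → EuclideanSpace ℝ (Fin 3)) (w : Fin m → ℝ),
        0 ≤ ∑ i, ∑ j, w i * w j * f (dist (y i) (y j))) ∧
      f 0 ≤ -(2 * P.energyPerParticle lennardJones) ∧
      (∀ r : ℝ, ρ ≤ r → 0 < r → f r ≤ lennardJones r) ∧
      (∀ r : ℝ, ρ ≤ r → (∃ a ∈ P.points, ∃ b ∈ P.points, a ≠ b ∧ r = dist a b) →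
        f r = lennardJones r) ∧
      f 0 + 2 * P.energyPerParticle (fun r => if r < ρ then f r else 0)
        + 2 * P.energyPerParticle (fun r => if r < ρ then 0 else lennardJones r) = 0 := by
  classical
  have hc := hs.c_nonneg
  -- touches on the tail distances of `P` (complementary slackness, tree)
  have htouch : ∀ r : ℝ, ρ ≤ r → (∃ a ∈ P.points, ∃ b ∈ P.points, a ≠ b ∧ r = dist a b) →
      f r = lennardJones r := by
    rintro r hρr ⟨a, ha, b, hb, hab, rfl⟩
    exact f_eq_lennardJones_of_mem_points hs hv ha hb hab (hρ.trans hρr)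
  -- the tail part of the `f`-energy equals the explicit `V_LJ`-tail energy (termwise)
  have htail : P.energyPerParticle (fun r => if r < ρ then 0 else f r)
      = P.energyPerParticle (fun r => if r < ρ then 0 else lennardJones r) := by
    unfold PeriodicConfiguration.energyPerParticle
    congr 1
    refine Finset.sum_congr rfl fun x hx => tsum_congr fun q => ?_
    simp only
    split_ifs with hlt
    · rfl
    · exact f_eq_lennardJones_of_mem_points hs hv (P.mem_points_of_mem_motif hx) q.2.1
        (fun heq => q.2.2 heq.symm) (hρ.trans (not_lt.1 hlt))
  -- the `f`-energy splits into core + tail (core has finite range, `f`-sites are summable)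
  have hsplit : P.energyPerParticle f =
      P.energyPerParticle (fun r => if r < ρ then f r else 0)
        + P.energyPerParticle (fun r => if r < ρ then 0 else f r) := by
    unfold PeriodicConfiguration.energyPerParticle
    rw [← mul_add, ← Finset.sum_add_distrib]
    congr 1
    refine Finset.sum_congr rfl fun x hx => ?_
    have hsum_f := summable_f_site hs hv (P.mem_points_of_mem_motif hx)
    have hsum_core : Summable fun q : {q : E3 // q ∈ P.points ∧ q ≠ x} =>
        (fun r => if r < ρ then f r else 0) (dist x q.1) :=
      summable_of_finRange P (core_of_le ρ f) x
    have hsum_tail : Summable fun q : {q : E3 // q ∈ P.points ∧ q ≠ x} =>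
        (fun r => if r < ρ then 0 else f r) (dist x q.1) := by
      refine (hsum_f.sub hsum_core).congr fun q => ?_
      simp only
      split_ifs <;> ring
    rw [← hsum_core.tsum_add hsum_tail]
    exact tsum_congr fun q => by simp only; split_ifs <;> ring
  have hneu := f_zero_add_two_mul_energyPerParticle_f hs hv
  refine ⟨hs.posType, ?_, fun r hρr hr => hs.f_le_tail (hρ.trans hρr) hr, htouch, ?_⟩
  · linarith
  · rw [hsplit, htail] at hneu
    linarith

end Witness

/-! ## L2 — completeness of finite sections (charge blow-up, contrapositively) -/

/-- **COMPLETENESS OF FINITE SECTIONS.**  Fix a template `P`, a range `ρ`, a ceiling `C` and finite touch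
sets `T N` that eventually contain every pair distance of `P` beyond `ρ`.  If for every `N` some radial
positive-type `f_N` with `f_N 0 ≤ C` lies below `V_LJ` on `[ρ,∞) ∩ (0,∞)`, touches `V_LJ` on `T N` and
satisfies the neutrality row, then ONE radial positive-type `f` does all of it on the full tail distance
set.  Proof: pointwise limit along the hyperfilter (`|f_N r| ≤ f_N 0 ≤ C` at `r ≥ 0`); every clause is
closed under pointwise limits, the neutrality row because the finite-range energy is a finite sum
(`tendsto_energyPerParticle_core`).  Contrapositive = CHARGE BLOW-UP: if the full tail system at ceiling `C`
is empty, some finite section at ceiling `C` is already empty. [folklore] -/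
theorem tailSection_complete (P : PeriodicConfiguration 3) (ρ C : ℝ) (T : ℕ → Finset ℝ)
    (hcov : ∀ r : ℝ, ρ ≤ r → (∃ a ∈ P.points, ∃ b ∈ P.points, a ≠ b ∧ r = dist a b) →
      ∃ N₀ : ℕ, ∀ N : ℕ, N₀ ≤ N → r ∈ T N)
    (h : ∀ N : ℕ, ∃ f : ℝ → ℝ,
      (∀ (m : ℕ) (y : Fin m → EuclideanSpace ℝ (Fin 3)) (w : Fin m → ℝ),
          0 ≤ ∑ i, ∑ j, w i * w j * f (dist (y i) (y j))) ∧
        f 0 ≤ C ∧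
        (∀ r : ℝ, ρ ≤ r → 0 < r → f r ≤ lennardJones r) ∧
        (∀ r ∈ T N, f r = lennardJones r) ∧
        f 0 + 2 * P.energyPerParticle (fun r => if r < ρ then f r else 0)
          + 2 * P.energyPerParticle (fun r => if r < ρ then 0 else lennardJones r) = 0) :
    ∃ f : ℝ → ℝ,
      (∀ (m : ℕ) (y : Fin m → EuclideanSpace ℝ (Fin 3)) (w : Fin m → ℝ),
          0 ≤ ∑ i, ∑ j, w i * w j * f (dist (y i) (y j))) ∧
        f 0 ≤ C ∧
        (∀ r : ℝ, ρ ≤ r → 0 < r → f r ≤ lennardJones r) ∧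
        (∀ r : ℝ, ρ ≤ r → (∃ a ∈ P.points, ∃ b ∈ P.points, a ≠ b ∧ r = dist a b) →
          f r = lennardJones r) ∧
        f 0 + 2 * P.energyPerParticle (fun r => if r < ρ then f r else 0)
          + 2 * P.energyPerParticle (fun r => if r < ρ then 0 else lennardJones r) = 0 := by
  classical
  choose f hpd hC hle heq hneu using h
  -- uniform bound `|f N r| ≤ |C|` at every `r ≥ 0`
  have hB : ∀ N (r : ℝ), 0 ≤ r → |f N r| ≤ |C| := fun N r hr =>
    (abs_le_f_zero (hpd N) hr).trans ((hC N).trans (le_abs_self C))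
  -- a non-principal ultrafilter and the pointwise ultralimit
  obtain ⟨𝒰, h𝒰⟩ : ∃ 𝒰 : Ultrafilter ℕ, (𝒰 : Filter ℕ) ≤ atTop :=
    ⟨hyperfilter ℕ, hyperfilter_le_cofinite.trans Nat.cofinite_eq_atTop.le⟩
  set F : ℝ → ℝ := fun r => limUnder (𝒰 : Filter ℕ) fun N => f N r with hFdef
  have hF : ∀ r : ℝ, 0 ≤ r → Tendsto (fun N => f N r) (𝒰 : Filter ℕ) (𝓝 (F r)) :=
    fun r hr => tendsto_limUnder_of_abs_le 𝒰 fun N => hB N r hr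
  refine ⟨F, fun n y w => ?_, ?_, fun r hρ hr => ?_, fun r hρr hab => ?_, ?_⟩
  · -- positive type passes to the limit
    have hTd : Tendsto (fun N => ∑ i, ∑ j, w i * w j * f N (dist (y i) (y j))) (𝒰 : Filter ℕ)
        (𝓝 (∑ i, ∑ j, w i * w j * F (dist (y i) (y j)))) :=
      tendsto_finsetSum _ fun i _ => tendsto_finsetSum _ fun j _ =>
        (hF (dist (y i) (y j)) dist_nonneg).const_mul (w i * w j)
    exact ge_of_tendsto' hTd fun N => hpd N n y w
  · -- the ceiling
    exact le_of_tendsto' (hF 0 le_rfl) fun N => hC N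
  · -- the sign clause on `[ρ,∞) ∩ (0,∞)`
    exact le_of_tendsto' (hF r hr.le) fun N => hle N r hρ hr
  · -- touches: eventually `f N r = V_LJ r`
    obtain ⟨N₀, hN₀⟩ := hcov r hρr hab
    have hr0 : 0 ≤ r := by obtain ⟨a, -, b, -, -, rfl⟩ := hab; exact dist_nonneg
    have hge : ∀ᶠ N in (𝒰 : Filter ℕ), N₀ ≤ N := h𝒰 (eventually_ge_atTop N₀)
    have hev : ∀ᶠ N in (𝒰 : Filter ℕ), f N r = lennardJones r :=
      hge.mono fun N hN => heq N r (hN₀ N hN)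
    exact tendsto_nhds_unique (hF r hr0) (tendsto_const_nhds.congr' (hev.mono fun N hN => hN.symm))
  · -- neutrality (finite-linear): pass the limit through the finite-range energy
    have hE := tendsto_energyPerParticle_core P ρ f F fun r hr _ => hF r hr
    have hsum : Tendsto (fun N => f N 0 + 2 * P.energyPerParticle (fun r => if r < ρ then f N r else 0)
        + 2 * P.energyPerParticle (fun r => if r < ρ then 0 else lennardJones r)) (𝒰 : Filter ℕ)
        (𝓝 (F 0 + 2 * P.energyPerParticle (fun r => if r < ρ then F r else 0)
          + 2 * P.energyPerParticle (fun r => if r < ρ then 0 else lennardJones r))) :=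
      ((hF 0 le_rfl).add (hE.const_mul 2)).add tendsto_const_nhds
    exact tendsto_nhds_unique hsum (tendsto_const_nhds.congr fun N => (hneu N).symm)

/-! ## L3 — the finite kill schema -/

/-- **AN EMPTY SECTION KILLS THE TEMPLATE AT EVERY RANGE `≤ ρ`.**  If for some touch set `T` of pair
distances of `P` beyond `ρ` NO radial positive-type `f` with the template's own ceiling `f 0 ≤ −2e(P)` lies
below `V_LJ` on `[ρ,∞) ∩ (0,∞)`, touches `V_LJ` on `T` and satisfies the neutrality row at `ρ`, then there is
no witness of the crux with template `P` and range `≤ ρ` (L1 + monotonicity of sections in the touch set).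
[folklore] -/
theorem not_witness_of_section_empty (P : PeriodicConfiguration 3) (ρ : ℝ) (T : Set ℝ)
    (hT : ∀ r ∈ T, ρ ≤ r ∧ ∃ a ∈ P.points, ∃ b ∈ P.points, a ≠ b ∧ r = dist a b)
    (h : ¬ ∃ f : ℝ → ℝ,
      (∀ (m : ℕ) (y : Fin m → EuclideanSpace ℝ (Fin 3)) (w : Fin m → ℝ),
          0 ≤ ∑ i, ∑ j, w i * w j * f (dist (y i) (y j))) ∧
        f 0 ≤ -(2 * P.energyPerParticle lennardJones) ∧
        (∀ r : ℝ, ρ ≤ r → 0 < r → f r ≤ lennardJones r) ∧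
        (∀ r ∈ T, f r = lennardJones r) ∧
        f 0 + 2 * P.energyPerParticle (fun r => if r < ρ then f r else 0)
          + 2 * P.energyPerParticle (fun r => if r < ρ then 0 else lennardJones r) = 0)
    {ρ' c : ℝ} {g U f : ℝ → ℝ} (hρ : ρ' ≤ ρ) (hs : IsSplit ρ' c g U f) :
    c + f 0 / 2 ≠ -(P.energyPerParticle lennardJones) := by
  intro hv
  obtain ⟨hpd, hC, hle, heq, hneu⟩ := tailSection_of_isSplit hs hv.le hρ
  exact h ⟨f, hpd, hC, hle, fun r hr => heq r (hT r hr).1 (hT r hr).2, hneu⟩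

/-! ## L4 — a finite Schoenberg-dual certificate empties a section (transfer as a hypothesis) -/

/-- **A DUAL CERTIFICATE EMPTIES A SECTION**, given the Schoenberg transfer principle `hS` as an explicit
hypothesis (radial positive-definite functions on `ℝ³` are `a·1_{0} + ∫ sinc(t r) dμ(t)`, `μ ≥ 0` —
Schoenberg 1938 — in the dual form: a finite kernel inequality `η + Σ_x K_x sinc(t S_x) ≤ 1` on `t ≥ 0`
with `η ≤ 1` transfers to `η f 0 + Σ_x K_x f(S_x) ≤ f 0` for every radial positive-type `f`).  Data: touch
radii `s j ∈ T` with free multipliers `lam j`; sign radii `u i ≥ ρ` with multipliers `σ i ≤ 0`; the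
neutrality multiplier `η ≤ 1`; the inner shells of `P` below `ρ` through which the finite-range energy
enters the neutrality row (abstractly: radii `q k > 0` with per-particle multiplicities `μ k`, `hinner`);
and `τ = −2 e_P(V_LJ·1_{[ρ,∞)})`.  If the dual function is `≤ 1` on `[0,∞)` and the dual value exceeds the
ceiling `C`, the section with ceiling `C` and touch set `T` is empty. [folklore] -/
theorem section_empty_of_dual
    (hS : ∀ (ι : Type) [Fintype ι] (S K : ι → ℝ) (η : ℝ), (∀ x, 0 < S x) → η ≤ 1 →
      (∀ t : ℝ, 0 ≤ t → η + ∑ x, K x * Real.sinc (t * S x) ≤ 1) →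
      ∀ f : ℝ → ℝ, (∀ (m : ℕ) (y : Fin m → EuclideanSpace ℝ (Fin 3)) (w : Fin m → ℝ),
          0 ≤ ∑ i, ∑ j, w i * w j * f (dist (y i) (y j))) →
        η * f 0 + ∑ x, K x * f (S x) ≤ f 0)
    (P : PeriodicConfiguration 3) (ρ C : ℝ)
    {m n p : ℕ} (s lam : Fin m → ℝ) (u σ : Fin n → ℝ) (q μ : Fin p → ℝ) (η τ : ℝ)
    (T : Set ℝ) (hs : ∀ j, s j ∈ T) (hT : ∀ r ∈ T, ρ ≤ r) (hu : ∀ i, ρ ≤ u i) (hρ : 0 < ρ)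
    (hσ : ∀ i, σ i ≤ 0) (hη : η ≤ 1) (hq : ∀ k, 0 < q k)
    (hinner : ∀ f : ℝ → ℝ,
      2 * P.energyPerParticle (fun r => if r < ρ then f r else 0) = ∑ k, μ k * f (q k))
    (hτ : τ = -(2 * P.energyPerParticle (fun r => if r < ρ then 0 else lennardJones r)))
    (hΦ : ∀ t : ℝ, 0 ≤ t →
      η * (1 + ∑ k, μ k * Real.sinc (t * q k)) + ∑ j, lam j * Real.sinc (t * s j)
        + ∑ i, σ i * Real.sinc (t * u i) ≤ 1)
    (hval : C < η * τ + ∑ j, lam j * lennardJones (s j) + ∑ i, σ i * lennardJones (u i)) :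
    ¬ ∃ f : ℝ → ℝ,
      (∀ (m : ℕ) (y : Fin m → EuclideanSpace ℝ (Fin 3)) (w : Fin m → ℝ),
          0 ≤ ∑ i, ∑ j, w i * w j * f (dist (y i) (y j))) ∧
        f 0 ≤ C ∧
        (∀ r : ℝ, ρ ≤ r → 0 < r → f r ≤ lennardJones r) ∧
        (∀ r ∈ T, f r = lennardJones r) ∧
        f 0 + 2 * P.energyPerParticle (fun r => if r < ρ then f r else 0)
          + 2 * P.energyPerParticle (fun r => if r < ρ then 0 else lennardJones r) = 0 := by
  rintro ⟨f, hpd, hC, hle, heq, hneu⟩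
  -- index the three families of radii by a sum type and apply the transfer once
  let ι := (Fin p ⊕ Fin m) ⊕ Fin n
  let S : ι → ℝ := fun x => match x with
    | Sum.inl (Sum.inl k) => q k
    | Sum.inl (Sum.inr j) => s j
    | Sum.inr i => u i
  let K : ι → ℝ := fun x => match x with
    | Sum.inl (Sum.inl k) => η * μ k
    | Sum.inl (Sum.inr j) => lam j
    | Sum.inr i => σ i
  have hSpos : ∀ x, 0 < S x := by
    rintro ((k | j) | i)
    · exact hq k
    · exact lt_of_lt_of_le hρ (hT _ (hs j))
    · exact lt_of_lt_of_le hρ (hu i)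
  have hker : ∀ t : ℝ, 0 ≤ t → η + ∑ x, K x * Real.sinc (t * S x) ≤ 1 := by
    intro t ht
    have := hΦ t ht
    simp only [ι, K, S, Fintype.sum_sum_type] at this ⊢
    have e1 : ∑ k, η * μ k * Real.sinc (t * q k) = η * ∑ k, μ k * Real.sinc (t * q k) := by
      rw [Finset.mul_sum]; refine Finset.sum_congr rfl fun k _ => by ring
    linarith [e1]
  have key := hS ι S K η hSpos hη hker f hpd
  simp only [ι, K, S, Fintype.sum_sum_type] at key
  have e1 : ∑ k, η * μ k * f (q k) = η * ∑ k, μ k * f (q k) := by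
    rw [Finset.mul_sum]; refine Finset.sum_congr rfl fun k _ => by ring
  rw [e1] at key
  -- neutrality in finite form: f 0 + Σ μ_k f(q_k) = τ
  have hN : f 0 + ∑ k, μ k * f (q k) = τ := by rw [← hinner f, hτ]; linarith
  -- touches and signs
  have hT' : ∑ j, lam j * f (s j) = ∑ j, lam j * lennardJones (s j) :=
    Finset.sum_congr rfl fun j _ => by rw [heq _ (hs j)]
  have hU : ∑ i, σ i * lennardJones (u i) ≤ ∑ i, σ i * f (u i) :=
    Finset.sum_le_sum fun i _ =>
      mul_le_mul_of_nonpos_left (hle (u i) (hu i) (lt_of_lt_of_le hρ (hu i))) (hσ i)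
  have : η * τ + ∑ j, lam j * lennardJones (s j) + ∑ i, σ i * lennardJones (u i) ≤ f 0 := by
    have h1 : η * f 0 + η * ∑ k, μ k * f (q k) = η * τ := by rw [← hN]; ring
    linarith
  linarith

/-! ## What the crux hands the lane, and the line's composition -/

/-- **A crux witness hands the lane a PERIODIC MINIMISER whose full tail sections are feasible at every
integer range beyond the witness's own** (with the witness's own `f`). [folklore] -/
theorem exists_minimiser_tailSection_of_exactCertificate (hE : ExactCertificate) :
    ∃ P : PeriodicConfiguration 3,
      (∀ Q : PeriodicConfiguration 3, P.energyPerParticle lennardJones ≤ Q.energyPerParticle lennardJones) ∧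
      ∃ n₀ : ℕ, ∀ n : ℕ, n₀ ≤ n → ∃ f : ℝ → ℝ,
        (∀ (m : ℕ) (y : Fin m → EuclideanSpace ℝ (Fin 3)) (w : Fin m → ℝ),
            0 ≤ ∑ i, ∑ j, w i * w j * f (dist (y i) (y j))) ∧
          f 0 ≤ -(2 * P.energyPerParticle lennardJones) ∧
          (∀ r : ℝ, (n : ℝ) ≤ r → 0 < r → f r ≤ lennardJones r) ∧
          (∀ r : ℝ, (n : ℝ) ≤ r → (∃ a ∈ P.points, ∃ b ∈ P.points, a ≠ b ∧ r = dist a b) →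
            f r = lennardJones r) ∧
          f 0 + 2 * P.energyPerParticle (fun r => if r < (n : ℝ) then f r else 0)
            + 2 * P.energyPerParticle (fun r => if r < (n : ℝ) then 0 else lennardJones r) = 0 := by
  obtain ⟨P, ρ, c, g, U, f, hs, hv⟩ := exactCertificate_iff.1 hE
  refine ⟨P, periodicMinimum_of_witness hs hv.le, ⌈ρ⌉₊, fun n hn => ⟨f, ?_⟩⟩
  have hρn : ρ ≤ (n : ℝ) := (Nat.le_ceil ρ).trans (by exact_mod_cast hn)
  exact tailSection_of_isSplit hs hv.le hρn

/-- **THE LINE'S COMPOSITION — `stub_tailEmpty → ¬ ExactCertificate`** (hypothesis = the registered stub of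
line `Ideator4Sketch`, verbatim): if the full tail section of every periodic minimiser of the Lennard-Jones
energy per particle is empty at every integer range (with the template's own ceiling), the crux fails —
a witness would hand over a periodic minimiser with a feasible section
(`exists_minimiser_tailSection_of_exactCertificate`). [folklore] -/
theorem not_exactCertificate_of_tailEmpty
    (hstub : ∀ (P : PeriodicConfiguration 3) (n : ℕ),
      (∀ Q : PeriodicConfiguration 3, P.energyPerParticle lennardJones ≤ Q.energyPerParticle lennardJones) →
      ¬ ∃ f : ℝ → ℝ,
        (∀ (m : ℕ) (y : Fin m → EuclideanSpace ℝ (Fin 3)) (w : Fin m → ℝ),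
          0 ≤ ∑ i, ∑ j, w i * w j * f (dist (y i) (y j))) ∧
        f 0 ≤ -(2 * P.energyPerParticle lennardJones) ∧
        (∀ r : ℝ, (n : ℝ) ≤ r → 0 < r → f r ≤ lennardJones r) ∧
        (∀ r : ℝ, (n : ℝ) ≤ r → (∃ a ∈ P.points, ∃ b ∈ P.points, a ≠ b ∧ r = dist a b) →
          f r = lennardJones r) ∧
        f 0 + 2 * P.energyPerParticle (fun r => if r < (n : ℝ) then f r else 0)
          + 2 * P.energyPerParticle (fun r => if r < (n : ℝ) then 0 else lennardJones r) = 0) :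
    ¬ ExactCertificate := by
  intro hE
  obtain ⟨P, hmin, n₀, hn₀⟩ := exists_minimiser_tailSection_of_exactCertificate hE
  exact hstub P n₀ hmin (hn₀ n₀ le_rfl)

/-- **Registered stub `stub_chargeBlowup` of line `Ideator4Sketch`** (signature verbatim): the line's
composition in closed form — tail sections of periodic minimisers empty at every integer range ⇒
`¬ ExactCertificate`. [folklore] -/
theorem stub_chargeBlowup :
    (∀ (P : PeriodicConfiguration 3) (n : ℕ),
      (∀ Q : PeriodicConfiguration 3, P.energyPerParticle lennardJones ≤ Q.energyPerParticle lennardJones) →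
      ¬ ∃ f : ℝ → ℝ,
        (∀ (m : ℕ) (y : Fin m → EuclideanSpace ℝ (Fin 3)) (w : Fin m → ℝ),
          0 ≤ ∑ i, ∑ j, w i * w j * f (dist (y i) (y j))) ∧
        f 0 ≤ -(2 * P.energyPerParticle lennardJones) ∧
        (∀ r : ℝ, (n : ℝ) ≤ r → 0 < r → f r ≤ lennardJones r) ∧
        (∀ r : ℝ, (n : ℝ) ≤ r → (∃ a ∈ P.points, ∃ b ∈ P.points, a ≠ b ∧ r = dist a b) →
          f r = lennardJones r) ∧
        f 0 + 2 * P.energyPerParticle (fun r => if r < (n : ℝ) then f r else 0)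
          + 2 * P.energyPerParticle (fun r => if r < (n : ℝ) then 0 else lennardJones r) = 0) →
    ¬ ExactCertificate :=
  not_exactCertificate_of_tailEmpty

end Summit.AtomisticToContinuum.Crystallization.Theorems.ThreeConeCertificateExactCertificate.ChargeBlowup

end
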